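import Mathlib.Logic.Function.Iterate
import Literature.IUT.LogThetaLattice.LogWallRemarks
import Literature.IUT.LogThetaLattice.LogLinkIterates
import Literature.AnabelianGeometry.AbsoluteAnabelian.LogShellsOfUnitLog
import Literature.IUT.LogThetaLattice.HolomorphicLogShellsProofs
import HarnessLib

/-!
# [IUTchIII] Rmk 1.2.2 (iii): «upper semi-commutativity» of the coric log-shells at the genuine local model

Mochizuki, *Inter-universal Teichmüller Theory III*, kurims manuscript (May 2020), §1, Rmk 1.2.2 (iii)
pp.36–37, Rmk 1.1.1 (i) p.28 [claim: Mochizuki2012, status: disputed] (D-0012 claim key; nothing here asserts a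
disputed claim or takes a side on [IUTchIII] Cor 3.12). PROOF-ONLY companion (theorems, no definitions) by the
zone holder abc-iut-L6-t3 (gen 7) — node of record IUTchIII:Rmk1.2.2(iii) = this seat's `LogLinkIterates.lean`
(p404701) — to abc-iut-L6-t1's SCHEMA file `LogWallRemarks.lean` (p404659), over abc-iut-L4-t3's `LogShells.lean`,
the standard model `PadicLogOnUnits.ofUnitLog` (`LogShellsOfUnitLog.lean`; abc-iut-S1's `unitLog = log_p`) and
abc-iut-L6-d2's `HolomorphicLogShellsProofs.lean`; nothing of theirs is restated. (The Rmk 1.1.1 (i) junction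
`unitsOnlyIterate` ↔ `iterDomain` is abc-iut-L6-t9's `LogWallRemarksProofs.lean`, not repeated here.)

Printed text (p.36 l.52 – p.37 l.17, `v ∈ V̲^non`): «the coric holomorphic log-shells of Proposition 1.2, (ix),
contain not only the images, via the Kummer isomorphisms …, of the various "`𝒪^▷`" …, but also the images, via
the composite of the Kummer isomorphisms with the various iterates of the log-link …, of the portions of the
various "`𝒪^▷`" on which these iterates are defined. … although the diagram … `Γ⃗` fails to be commutative, the
coric holomorphic log-shells involved exhibit a sort of "upper semi-commutativity" with respect to containing
… the various images arising from composites of arrows in `Γ⃗`.»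

abc-iut-L6-t1 typed the last sentence as the free SCHEMA `UpperSemiCommutative shell images := ∀ i, images i ⊆
shell`; this seat's `LogLinkIterates.lean` typed the objects concretely over abc-iut-L4-t3's `PadicLogOnUnits K`
(`log_k` on `𝒪_k^× = {‖x‖ = 1}`): the domains `iterDomain L n` (`D_0 = k`, `D_{n+1} = 𝒪_k^× ∩ log_k⁻¹(D_n)`) and
`iterate_image_subset_logShell` (`log_k^{[n+1]}(D_{n+1}) ⊆ ℐ_k` given `ℐ* ⊆ ℐ`). This file proves that the SCHEMA
HOLDS at that model for the printed family of images — indexed by the number `n ≥ 0` of log-links preceding the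
Kummer isomorphism, `n ↦ log_k^{[n]}(D_n ∩ 𝒪_k^▷)` (`n = 0`: `𝒪_k^▷` itself):
* `upperSemiCommutative_logShell` — for every `PadicLogOnUnits K` with `ℐ* = log_k(𝒪_k^×) ⊆ ℐ_k` ([IUTchIII]
  Prop 1.2 (v) (c)): `n = 0` is abc-iut-L4-t3's `closedBall_subset_logShell` (`𝒪_k ⊆ ℐ_k`, [AbsTopIII] Def 5.4
  (iii)), `n ≥ 1` is this seat's `iterate_image_subset_logShell`;
* `iUnion_iterate_image_subset_logShell` — hence (abc-iut-L6-t1's `UpperSemiCommutative.iUnion_subset`) the union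
  over ALL composites of arrows lies in `ℐ_k` — the «upper estimate» form used by Rmk 1.5.4 (iii);
* `upperSemiCommutative_logShell_ofUnitLog`, `iUnion_iterate_image_subset_logShell_ofUnitLog` — the same
  UNCONDITIONALLY at the genuine `p_v`-adic logarithm `PadicLogOnUnits.ofUnitLog p K` of any proper ultrametric
  `ℚ_p`-normed field `K` (e.g. an MLF), abc-iut-L6-d2's `preLogShell_subset_logShell_ofUnitLog` discharging
  `ℐ* ⊆ ℐ`.
HONEST FRAMING: elementary consequences of the typed definitions; no new `Prop` fact; typed ≠ proved for the
series' claims; no side taken.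
-/

namespace Literature.IUT.LogThetaLattice

open Set Metric Function
open Literature.AnabelianGeometry.AbsoluteAnabelian

section Model

variable {K : Type} [NontriviallyNormedField K] (L : PadicLogOnUnits K)

/-- **IUTchIII:Rmk1.2.2(iii)** (kurims pp.36–37) abc-iut-L6-t1's SCHEMA `UpperSemiCommutative` HOLDS at the local
model of the log-shell: for every `PadicLogOnUnits K` with `ℐ* = log_k(𝒪_k^×) ⊆ ℐ_k` ([IUTchIII] Prop 1.2 (v)
(c)), the [coric holomorphic] log-shell `ℐ_k` «contain[s] not only the images … of the various "`𝒪^▷`" …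
[`n = 0`] but also the images, via … the various iterates of the log-link [`n ≥ 1`], of the portions of the
various "`𝒪^▷`" on which these iterates are defined» — the family of images indexed by the number `n` of
log-links preceding the Kummer isomorphism, `n ↦ log_k^{[n]}(D_n ∩ 𝒪_k^▷)`.
[claim: Mochizuki2012, status: disputed] -/
theorem upperSemiCommutative_logShell [IsUltrametricDist K] (hc : preLogShell L ⊆ logShell L) :
    UpperSemiCommutative (logShell L)
      (fun n : ℕ => L.log^[n] '' (iterDomain L n ∩ {a : K | ‖a‖ ≤ 1 ∧ a ≠ 0})) := by
  intro n
  cases n with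
  | zero =>
    rintro _ ⟨a, ⟨-, ha⟩, rfl⟩
    rw [iterate_zero, id_eq]
    exact closedBall_subset_logShell L (by rw [mem_closedBall, dist_zero_right]; exact ha.1)
  | succ n =>
    rintro _ ⟨a, ⟨ha, -⟩, rfl⟩
    exact iterate_image_subset_logShell L hc n ⟨a, ha, rfl⟩

/-- **IUTchIII:Rmk1.2.2(iii)** (kurims pp.36–37) … hence the union over ALL composites of arrows of `Γ⃗` lies in the
log-shell (abc-iut-L6-t1's formal consequence `UpperSemiCommutative.iUnion_subset`, now at the local model):
`⋃_n log_k^{[n]}(D_n ∩ 𝒪_k^▷) ⊆ ℐ_k`. [claim: Mochizuki2012, status: disputed] -/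
theorem iUnion_iterate_image_subset_logShell [IsUltrametricDist K] (hc : preLogShell L ⊆ logShell L) :
    (⋃ n : ℕ, L.log^[n] '' (iterDomain L n ∩ {a : K | ‖a‖ ≤ 1 ∧ a ≠ 0})) ⊆ logShell L :=
  (upperSemiCommutative_logShell L hc).iUnion_subset

end Model

section Genuine

variable (p : ℕ) [Fact p.Prime] (K : Type) [NontriviallyNormedField K] [NormedAlgebra ℚ_[p] K]
  [IsUltrametricDist K] [ProperSpace K]

/-- **IUTchIII:Rmk1.2.2(iii)** (kurims pp.36–37) «upper semi-commutativity» UNCONDITIONALLY at the genuine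
`p_v`-adic logarithm: for the standard model `PadicLogOnUnits.ofUnitLog p K` (`log := log_p` = abc-iut-S1's
`unitLog`) of any proper ultrametric `ℚ_p`-normed field `K` (e.g. an MLF), the log-shell
`ℐ_K = (p*)⁻¹·log_p(𝒪_K^×)` contains `log_p^{[n]}` of the portion of `𝒪_K^▷` on which the `n`-th iterate of the
log-link is defined, for every `n ≥ 0` (abc-iut-L6-d2's `preLogShell_subset_logShell_ofUnitLog` discharges
`ℐ* ⊆ ℐ`). [claim: Mochizuki2012, status: disputed] -/
theorem upperSemiCommutative_logShell_ofUnitLog :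
    UpperSemiCommutative (logShell (PadicLogOnUnits.ofUnitLog p K))
      (fun n : ℕ => (PadicLogOnUnits.ofUnitLog p K).log^[n] ''
        (iterDomain (PadicLogOnUnits.ofUnitLog p K) n ∩ {a : K | ‖a‖ ≤ 1 ∧ a ≠ 0})) :=
  upperSemiCommutative_logShell _ (preLogShell_subset_logShell_ofUnitLog p K)

/-- **IUTchIII:Rmk1.2.2(iii)** (kurims pp.36–37) … and the union over all composites of arrows, at the genuine
`p_v`-adic logarithm: `⋃_n log_p^{[n]}(D_n ∩ 𝒪_K^▷) ⊆ ℐ_K`. [claim: Mochizuki2012, status: disputed] -/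
theorem iUnion_iterate_image_subset_logShell_ofUnitLog :
    (⋃ n : ℕ, (PadicLogOnUnits.ofUnitLog p K).log^[n] ''
        (iterDomain (PadicLogOnUnits.ofUnitLog p K) n ∩ {a : K | ‖a‖ ≤ 1 ∧ a ≠ 0})) ⊆
      logShell (PadicLogOnUnits.ofUnitLog p K) :=
  iUnion_iterate_image_subset_logShell _ (preLogShell_subset_logShell_ofUnitLog p K)

end Genuine

end Literature.IUT.LogThetaLattice
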